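import Summits.Ventures.PercRepro2.CaseOneMarkLeafB
import Summits.Ventures.PercRepro2.CaseOneLeafDelete
import Summits.Ventures.PercRepro2.CaseOneThickeningRel

/-!
# A pendant mark `o` or `b` is pulled back to its neighbour (blind cell PercRepro2, p1 g29; two mark
moves — reduction rules for the rung)

If `o` is a leaf at `y` through `e₀` (`o ∉ {a₁, a₂, a₃, b}`), then `{o ∈ C_i} = {e₀ open} ∩ {y ∈ C_i}`
and the leaf edge is independent of every event among the other vertices, so every `o`-mass of the
case-1 forms at `a₃` is `p(e₀)` times the `y`-mass of `G − e₀` and the other masses are unchanged: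
**`iiExprT_o_move`** / **`iExprT_o_move`** — the forms of `(G, o)` at `(c₀, c₁)` are those of
`(G − e₀, y)` at `(c₀, p(e₀) c₁)` — and the threshold pairs scale the same way (`Dpdo_o_move`,
`Dqo_o_move`). Hence **`closedAt_of_o_move`**: a pendant `o` is REPLACED BY ITS NEIGHBOUR; likewise a
pendant `b` (**`closedAt_of_b_move`**: the `b`-masses carry the factor, nothing else changes), and the
pocket forms `closedAt_of_o_pocket_move` / `closedAt_of_b_pocket_move`. Read downward: in a residual
instance of the rung neither `o` nor `b` is a leaf. Own code; standard axioms.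
-/

namespace Summit.Ventures.PercRepro2

namespace CaseOne

/-! ## Scaling the threshold pair -/

section Scale
variable {V : Type*} {E : Type*} [Fintype E] [DecidableEq E] {R : Type*} [CommRing R]

/-- `iiExprT` is linear in the threshold pair. -/
lemma iiExprT_mul_pair (p : E → R) (ends : E → Sym2 V) (o a₁ a₂ a₃ b : V) (r c₀ c₁ : R) :
    iiExprT p ends o a₁ a₂ a₃ b (r * c₀) (r * c₁) = r * iiExprT p ends o a₁ a₂ a₃ b c₀ c₁ := by
  rw [iiExprT_eq, iiExprT_eq]
  ring

/-- `iExprT` is linear in the threshold pair. -/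
lemma iExprT_mul_pair (p : E → R) (ends : E → Sym2 V) (o a₁ a₂ a₃ b : V) (r c₀ c₁ : R) :
    iExprT p ends o a₁ a₂ a₃ b (r * c₀) (r * c₁) = r * iExprT p ends o a₁ a₂ a₃ b c₀ c₁ := by
  rw [iExprT_eq, iExprT_eq]
  ring

end Scale

/-! ## The mark `o` pendant at `y` -/

section OMove
variable {V : Type*} {E : Type*} [Fintype E] [DecidableEq E] {R : Type*} [CommRing R]
variable {ends : E → Sym2 V} {o a₁ a₂ a₃ b y : V} {e₀ : E}

omit [Fintype E] [DecidableEq E] in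
/-- `{o ∈ C₂} ∩ X = {y ↔ o} ∩ ({y ∈ C₂} ∩ X)` for `o` a leaf at `y`, as sets of configurations. -/
lemma o_move_set₂ (hl : IsLeafAt ends y o e₀) (h2 : a₂ ≠ o) (X : Set (Config E)) :
    connEvent ends a₂ o ∩ X = connEvent ends y o ∩ (connEvent ends a₂ y ∩ X) := by
  ext ω
  simp only [Set.mem_inter_iff, mem_connEvent]
  rw [conn_leaf_at_iff hl ω h2, conn_leaf_iff hl ω]
  tauto

omit [Fintype E] [DecidableEq E] in
/-- `{o ∈ U} ∩ X = {y ↔ o} ∩ ({y ∈ U} ∩ X)` for `o` a leaf at `y`. -/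
lemma o_move_setU (hl : IsLeafAt ends y o e₀) (h1 : a₁ ≠ o) (h2 : a₂ ≠ o) (X : Set (Config E)) :
    (connEvent ends a₁ o ∪ connEvent ends a₂ o) ∩ X =
      connEvent ends y o ∩ ((connEvent ends a₁ y ∪ connEvent ends a₂ y) ∩ X) := by
  ext ω
  simp only [Set.mem_inter_iff, Set.mem_union, mem_connEvent]
  rw [conn_leaf_at_iff hl ω h1, conn_leaf_at_iff hl ω h2, conn_leaf_iff hl ω]
  tauto

/-- `P(Q, b ∈ C₂, a₃ ∈ C₁, o ∈ C₂)` for `o` pendant at `y`. -/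
lemma o_move_mass₁ (p : E → R) (hl : IsLeafAt ends y o e₀) (h1 : a₁ ≠ o) (h2 : a₂ ≠ o)
    (h3 : a₃ ≠ o) (hb : b ≠ o) :
    prob p (connEvent ends a₂ b ∩ connEvent ends a₁ a₃ ∩ connEvent ends a₂ o ∩
      (connEvent ends a₁ a₂)ᶜ) =
      p e₀ * prob (restrictW p e₀) (connEvent (restrictEnds ends e₀) a₂ b ∩
        connEvent (restrictEnds ends e₀) a₁ a₃ ∩ connEvent (restrictEnds ends e₀) a₂ y ∩
        (connEvent (restrictEnds ends e₀) a₁ a₂)ᶜ) := by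
  have e : connEvent ends a₂ b ∩ connEvent ends a₁ a₃ ∩ connEvent ends a₂ o ∩
      (connEvent ends a₁ a₂)ᶜ = connEvent ends a₂ o ∩ (connEvent ends a₂ b ∩ connEvent ends a₁ a₃ ∩
      (connEvent ends a₁ a₂)ᶜ) := by
    ext ω; simp only [Set.mem_inter_iff, Set.mem_compl_iff]; tauto
  rw [e, o_move_set₂ hl h2, prob_connEvent_leaf_inter p hl]
  · congr 1
    have e' : connEvent ends a₂ y ∩ (connEvent ends a₂ b ∩ connEvent ends a₁ a₃ ∩
        (connEvent ends a₁ a₂)ᶜ) = connEvent ends a₂ b ∩ connEvent ends a₁ a₃ ∩ connEvent ends a₂ y ∩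
        (connEvent ends a₁ a₂)ᶜ := by
      ext ω; simp only [Set.mem_inter_iff, Set.mem_compl_iff]; tauto
    rw [e', connEvent_restrict hl h2 hb, connEvent_restrict hl h1 h3, connEvent_restrict hl h2 hl.ne,
      connEvent_restrict hl h1 h2]
    simp only [← Set.preimage_compl, ← Set.preimage_inter, prob_restrict]
  · intro ω c
    simp only [Set.mem_inter_iff, Set.mem_compl_iff]
    rw [mem_connEvent_update_of_leaf hl ω c h2 hl.ne, mem_connEvent_update_of_leaf hl ω c h2 hb,
      mem_connEvent_update_of_leaf hl ω c h1 h3, mem_connEvent_update_of_leaf hl ω c h1 h2]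

/-- `P(Q, a₃ ∈ C₁, o ∈ C₂)` for `o` pendant at `y`. -/
lemma o_move_mass₂ (p : E → R) (hl : IsLeafAt ends y o e₀) (h1 : a₁ ≠ o) (h2 : a₂ ≠ o)
    (h3 : a₃ ≠ o) :
    prob p (connEvent ends a₁ a₃ ∩ connEvent ends a₂ o ∩ (connEvent ends a₁ a₂)ᶜ) =
      p e₀ * prob (restrictW p e₀) (connEvent (restrictEnds ends e₀) a₁ a₃ ∩
        connEvent (restrictEnds ends e₀) a₂ y ∩ (connEvent (restrictEnds ends e₀) a₁ a₂)ᶜ) := by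
  have e : connEvent ends a₁ a₃ ∩ connEvent ends a₂ o ∩ (connEvent ends a₁ a₂)ᶜ =
      connEvent ends a₂ o ∩ (connEvent ends a₁ a₃ ∩ (connEvent ends a₁ a₂)ᶜ) := by
    ext ω; simp only [Set.mem_inter_iff, Set.mem_compl_iff]; tauto
  rw [e, o_move_set₂ hl h2, prob_connEvent_leaf_inter p hl]
  · congr 1
    have e' : connEvent ends a₂ y ∩ (connEvent ends a₁ a₃ ∩ (connEvent ends a₁ a₂)ᶜ) =
        connEvent ends a₁ a₃ ∩ connEvent ends a₂ y ∩ (connEvent ends a₁ a₂)ᶜ := by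
      ext ω; simp only [Set.mem_inter_iff, Set.mem_compl_iff]; tauto
    rw [e', connEvent_restrict hl h1 h3, connEvent_restrict hl h2 hl.ne, connEvent_restrict hl h1 h2]
    simp only [← Set.preimage_compl, ← Set.preimage_inter, prob_restrict]
  · intro ω c
    simp only [Set.mem_inter_iff, Set.mem_compl_iff]
    rw [mem_connEvent_update_of_leaf hl ω c h2 hl.ne, mem_connEvent_update_of_leaf hl ω c h1 h3,
      mem_connEvent_update_of_leaf hl ω c h1 h2]

/-- `P(Q, b ∈ C₁, a₃ ∈ C₁, o ∈ C₂)` for `o` pendant at `y`. -/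
lemma o_move_mass₃ (p : E → R) (hl : IsLeafAt ends y o e₀) (h1 : a₁ ≠ o) (h2 : a₂ ≠ o)
    (h3 : a₃ ≠ o) (hb : b ≠ o) :
    prob p (connEvent ends a₁ b ∩ connEvent ends a₁ a₃ ∩ connEvent ends a₂ o ∩
      (connEvent ends a₁ a₂)ᶜ) =
      p e₀ * prob (restrictW p e₀) (connEvent (restrictEnds ends e₀) a₁ b ∩
        connEvent (restrictEnds ends e₀) a₁ a₃ ∩ connEvent (restrictEnds ends e₀) a₂ y ∩
        (connEvent (restrictEnds ends e₀) a₁ a₂)ᶜ) := by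
  have e : connEvent ends a₁ b ∩ connEvent ends a₁ a₃ ∩ connEvent ends a₂ o ∩
      (connEvent ends a₁ a₂)ᶜ = connEvent ends a₂ o ∩ (connEvent ends a₁ b ∩ connEvent ends a₁ a₃ ∩
      (connEvent ends a₁ a₂)ᶜ) := by
    ext ω; simp only [Set.mem_inter_iff, Set.mem_compl_iff]; tauto
  rw [e, o_move_set₂ hl h2, prob_connEvent_leaf_inter p hl]
  · congr 1
    have e' : connEvent ends a₂ y ∩ (connEvent ends a₁ b ∩ connEvent ends a₁ a₃ ∩
        (connEvent ends a₁ a₂)ᶜ) = connEvent ends a₁ b ∩ connEvent ends a₁ a₃ ∩ connEvent ends a₂ y ∩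
        (connEvent ends a₁ a₂)ᶜ := by
      ext ω; simp only [Set.mem_inter_iff, Set.mem_compl_iff]; tauto
    rw [e', connEvent_restrict hl h1 hb, connEvent_restrict hl h1 h3, connEvent_restrict hl h2 hl.ne,
      connEvent_restrict hl h1 h2]
    simp only [← Set.preimage_compl, ← Set.preimage_inter, prob_restrict]
  · intro ω c
    simp only [Set.mem_inter_iff, Set.mem_compl_iff]
    rw [mem_connEvent_update_of_leaf hl ω c h2 hl.ne, mem_connEvent_update_of_leaf hl ω c h1 hb,
      mem_connEvent_update_of_leaf hl ω c h1 h3, mem_connEvent_update_of_leaf hl ω c h1 h2]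

/-- `D_o` for `o` pendant at `y`: `p(e₀)` times `D_y` of `G − e₀`. -/
lemma Dpdo_o_move (p : E → R) (hl : IsLeafAt ends y o e₀) (h1 : a₁ ≠ o) (h2 : a₂ ≠ o)
    (h3 : a₃ ≠ o) :
    Dpdo p ends o a₁ a₂ a₃ = p e₀ * Dpdo (restrictW p e₀) (restrictEnds ends e₀) y a₁ a₂ a₃ := by
  unfold Dpdo
  have e : (connEvent ends a₁ o ∪ connEvent ends a₂ o) ∩ (connEvent ends a₁ a₃)ᶜ ∩
      (connEvent ends a₂ a₃)ᶜ ∩ (connEvent ends a₁ a₂)ᶜ = (connEvent ends a₁ o ∪ connEvent ends a₂ o) ∩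
      ((connEvent ends a₁ a₃)ᶜ ∩ (connEvent ends a₂ a₃)ᶜ ∩ (connEvent ends a₁ a₂)ᶜ) := by
    simp only [Set.inter_assoc]
  rw [e, o_move_setU hl h1 h2, prob_connEvent_leaf_inter p hl]
  · congr 1
    have e' : (connEvent ends a₁ y ∪ connEvent ends a₂ y) ∩ ((connEvent ends a₁ a₃)ᶜ ∩
        (connEvent ends a₂ a₃)ᶜ ∩ (connEvent ends a₁ a₂)ᶜ) = (connEvent ends a₁ y ∪ connEvent ends a₂ y) ∩
        (connEvent ends a₁ a₃)ᶜ ∩ (connEvent ends a₂ a₃)ᶜ ∩ (connEvent ends a₁ a₂)ᶜ := by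
      simp only [Set.inter_assoc]
    rw [e', connEvent_restrict hl h1 hl.ne, connEvent_restrict hl h2 hl.ne,
      connEvent_restrict hl h1 h3, connEvent_restrict hl h2 h3, connEvent_restrict hl h1 h2]
    simp only [← Set.preimage_compl, ← Set.preimage_inter, ← Set.preimage_union, prob_restrict]
  · intro ω c
    simp only [Set.mem_inter_iff, Set.mem_union, Set.mem_compl_iff]
    rw [mem_connEvent_update_of_leaf hl ω c h1 hl.ne, mem_connEvent_update_of_leaf hl ω c h2 hl.ne,
      mem_connEvent_update_of_leaf hl ω c h1 h3, mem_connEvent_update_of_leaf hl ω c h2 h3,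
      mem_connEvent_update_of_leaf hl ω c h1 h2]

/-- `P(Q, o ∈ U)` for `o` pendant at `y`: `p(e₀)` times `P(Q, y ∈ U)` of `G − e₀`. -/
lemma Dqo_o_move (p : E → R) (hl : IsLeafAt ends y o e₀) (h1 : a₁ ≠ o) (h2 : a₂ ≠ o) :
    Dqo p ends o a₁ a₂ = p e₀ * Dqo (restrictW p e₀) (restrictEnds ends e₀) y a₁ a₂ := by
  unfold Dqo
  rw [o_move_setU hl h1 h2, prob_connEvent_leaf_inter p hl]
  · congr 1
    rw [connEvent_restrict hl h1 hl.ne, connEvent_restrict hl h2 hl.ne, connEvent_restrict hl h1 h2]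
    simp only [← Set.preimage_compl, ← Set.preimage_inter, ← Set.preimage_union, prob_restrict]
  · intro ω c
    simp only [Set.mem_inter_iff, Set.mem_union, Set.mem_compl_iff]
    rw [mem_connEvent_update_of_leaf hl ω c h1 hl.ne, mem_connEvent_update_of_leaf hl ω c h2 hl.ne,
      mem_connEvent_update_of_leaf hl ω c h1 h2]

/-- **The `(ii)` form of `(G, o)` at `(c₀, c₁)` is the `(ii)` form of `(G − e₀, y)` at
`(c₀, p(e₀) c₁)`** when `o` is a leaf at `y`. -/
theorem iiExprT_o_move (p : E → R) (hl : IsLeafAt ends y o e₀) (h1 : a₁ ≠ o) (h2 : a₂ ≠ o)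
    (h3 : a₃ ≠ o) (hb : b ≠ o) (c₀ c₁ : R) :
    iiExprT p ends o a₁ a₂ a₃ b c₀ c₁ =
      iiExprT (restrictW p e₀) (restrictEnds ends e₀) y a₁ a₂ a₃ b c₀ (p e₀ * c₁) := by
  rw [iiExprT_eq, iiExprT_eq, o_move_mass₁ p hl h1 h2 h3 hb, o_move_mass₂ p hl h1 h2 h3,
    probQ_restrict p hl h1 h2, connEvent_restrict hl h2 hb, connEvent_restrict hl h1 h3,
    connEvent_restrict hl h1 h2]
  simp only [← Set.preimage_compl, ← Set.preimage_inter, prob_restrict]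
  ring

/-- **The `(i)` form of `(G, o)` at `(c₀, c₁)` is the `(i)` form of `(G − e₀, y)` at
`(c₀, p(e₀) c₁)`** when `o` is a leaf at `y`. -/
theorem iExprT_o_move (p : E → R) (hl : IsLeafAt ends y o e₀) (h1 : a₁ ≠ o) (h2 : a₂ ≠ o)
    (h3 : a₃ ≠ o) (hb : b ≠ o) (c₀ c₁ : R) :
    iExprT p ends o a₁ a₂ a₃ b c₀ c₁ =
      iExprT (restrictW p e₀) (restrictEnds ends e₀) y a₁ a₂ a₃ b c₀ (p e₀ * c₁) := by
  rw [iExprT_eq, iExprT_eq, o_move_mass₃ p hl h1 h2 h3 hb, o_move_mass₂ p hl h1 h2 h3,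
    probQ_restrict p hl h1 h2, connEvent_restrict hl h1 hb, connEvent_restrict hl h1 h3,
    connEvent_restrict hl h1 h2]
  simp only [← Set.preimage_compl, ← Set.preimage_inter, prob_restrict]
  ring

variable [LinearOrder R] [IsStrictOrderedRing R]

/-- **The four forms at `a₃` for `(G − e₀, y)` give them for `(G, o)`** when `o` is a leaf at `y`. -/
theorem fourForms_of_o_move {p : E → R} (hp : IsProbVec p) (hl : IsLeafAt ends y o e₀) (h1 : a₁ ≠ o)
    (h2 : a₂ ≠ o) (h3 : a₃ ≠ o) (hb : b ≠ o)
    (h : FourForms (restrictW p e₀) (restrictEnds ends e₀) y a₁ a₂ a₃ b) :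
    FourForms p ends o a₁ a₂ a₃ b := by
  obtain ⟨hii, hiiq, hi, hiq⟩ := h
  have hq := hp.nonneg e₀
  refine ⟨?_, ?_, ?_, ?_⟩
  · unfold ZSplitII
    rw [iiExpr_eq_iiExprT, iiExprT_o_move p hl h1 h2 h3 hb, Dpdo_o_move p hl h1 h2 h3,
      Dpd_restrict p hl h1 h2 h3, iiExprT_mul_pair]
    rw [ZSplitII, iiExpr_eq_iiExprT] at hii
    exact mul_nonneg hq hii
  · unfold ZSplitIIQ
    rw [iiExprT_o_move p hl h1 h2 h3 hb, Dqo_o_move p hl h1 h2, probQ_restrict p hl h1 h2,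
      iiExprT_mul_pair]
    exact mul_nonneg hq hiiq
  · unfold ZSplitI
    rw [iExpr_eq_iExprT, iExprT_o_move p hl h1 h2 h3 hb, Dpdo_o_move p hl h1 h2 h3,
      Dpd_restrict p hl h1 h2 h3, iExprT_mul_pair]
    rw [ZSplitI, iExpr_eq_iExprT] at hi
    exact mul_nonneg hq hi
  · unfold ZSplitIQ
    rw [iExprT_o_move p hl h1 h2 h3 hb, Dqo_o_move p hl h1 h2, probQ_restrict p hl h1 h2,
      iExprT_mul_pair]
    exact mul_nonneg hq hiq

end OMove

/-! ## The mark `b` pendant at `y` -/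

section BMove
variable {V : Type*} {E : Type*} [Fintype E] [DecidableEq E] {R : Type*} [CommRing R]
variable {ends : E → Sym2 V} {o a₁ a₂ a₃ b y : V} {e₀ : E}

omit [Fintype E] [DecidableEq E] in
/-- `{u ↔ b} ∩ X = {y ↔ b} ∩ ({u ↔ y} ∩ X)` for `b` a leaf at `y` and `u ≠ b`. -/
lemma b_move_set (hl : IsLeafAt ends y b e₀) {u : V} (hu : u ≠ b) (X : Set (Config E)) :
    connEvent ends u b ∩ X = connEvent ends y b ∩ (connEvent ends u y ∩ X) := by
  ext ω
  simp only [Set.mem_inter_iff, mem_connEvent]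
  rw [conn_leaf_at_iff hl ω hu, conn_leaf_iff hl ω]
  tauto

/-- A `b`-mass `P({u ↔ b} ∩ X)` for `b` pendant at `y`, with `X` an event among the other vertices
given as a preimage from `G − e₀`. -/
lemma prob_b_move (p : E → R) (hl : IsLeafAt ends y b e₀) {u : V} (hu : u ≠ b)
    (X : Set (Config {e : E // e ≠ e₀}))
    (hX : ∀ ω c, Function.update ω e₀ c ∈ restrictCfg e₀ ⁻¹' X ↔ ω ∈ restrictCfg e₀ ⁻¹' X) :
    prob p (connEvent ends u b ∩ restrictCfg e₀ ⁻¹' X) =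
      p e₀ * prob (restrictW p e₀) (connEvent (restrictEnds ends e₀) u y ∩ X) := by
  rw [b_move_set hl hu, prob_connEvent_leaf_inter p hl]
  · rw [connEvent_restrict hl hu hl.ne, ← Set.preimage_inter, prob_restrict]
  · intro ω c
    simp only [Set.mem_inter_iff]
    rw [mem_connEvent_update_of_leaf hl ω c hu hl.ne, hX ω c]

omit [Fintype E] in
/-- The preimage of an event of `G − e₀` ignores `e₀`. -/
lemma preimage_restrict_update (e₀ : E) (X : Set (Config {e : E // e ≠ e₀})) (ω : Config E)
    (c : Bool) : Function.update ω e₀ c ∈ restrictCfg e₀ ⁻¹' X ↔ ω ∈ restrictCfg e₀ ⁻¹' X := by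
  simp only [Set.mem_preimage, restrictCfg_update]

/-- **The `(ii)` form of `(G, b)` at `(c₀, c₁)` is `p(e₀)` times the `(ii)` form of `(G − e₀, y)`**
when `b` is a leaf at `y`. -/
theorem iiExprT_b_move (p : E → R) (hl : IsLeafAt ends y b e₀) (ho : o ≠ b) (h1 : a₁ ≠ b)
    (h2 : a₂ ≠ b) (h3 : a₃ ≠ b) (c₀ c₁ : R) :
    iiExprT p ends o a₁ a₂ a₃ b c₀ c₁ =
      p e₀ * iiExprT (restrictW p e₀) (restrictEnds ends e₀) o a₁ a₂ a₃ y c₀ c₁ := by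
  rw [iiExprT_eq, iiExprT_eq]
  have m1 := prob_b_move p hl h2 (connEvent (restrictEnds ends e₀) a₁ a₃ ∩
    connEvent (restrictEnds ends e₀) a₂ o ∩ (connEvent (restrictEnds ends e₀) a₁ a₂)ᶜ)
    (preimage_restrict_update e₀ _)
  have m2 := prob_b_move p hl h2 ((connEvent (restrictEnds ends e₀) a₁ a₂)ᶜ)
    (preimage_restrict_update e₀ _)
  have m3 := prob_b_move p hl h2 (connEvent (restrictEnds ends e₀) a₁ a₃ ∩
    (connEvent (restrictEnds ends e₀) a₁ a₂)ᶜ) (preimage_restrict_update e₀ _)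
  simp only [Set.preimage_inter, Set.preimage_compl, ← connEvent_restrict hl h1 h3,
    ← connEvent_restrict hl h2 ho, ← connEvent_restrict hl h1 h2] at m1 m2 m3
  have e1 : connEvent ends a₂ b ∩ connEvent ends a₁ a₃ ∩ connEvent ends a₂ o ∩
      (connEvent ends a₁ a₂)ᶜ = connEvent ends a₂ b ∩ (connEvent ends a₁ a₃ ∩ connEvent ends a₂ o ∩
      (connEvent ends a₁ a₂)ᶜ) := by
    simp only [Set.inter_assoc]
  have e3 : connEvent ends a₂ b ∩ connEvent ends a₁ a₃ ∩ (connEvent ends a₁ a₂)ᶜ =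
      connEvent ends a₂ b ∩ (connEvent ends a₁ a₃ ∩ (connEvent ends a₁ a₂)ᶜ) := by
    simp only [Set.inter_assoc]
  rw [e1, e3, m1, m2, m3, probQ_restrict p hl h1 h2, connEvent_restrict hl h1 h3,
    connEvent_restrict hl h2 ho, connEvent_restrict hl h1 h2]
  simp only [← Set.preimage_compl, ← Set.preimage_inter, prob_restrict, Set.inter_assoc]
  ring

/-- **The `(i)` form of `(G, b)` at `(c₀, c₁)` is `p(e₀)` times the `(i)` form of `(G − e₀, y)`**
when `b` is a leaf at `y`. -/
theorem iExprT_b_move (p : E → R) (hl : IsLeafAt ends y b e₀) (ho : o ≠ b) (h1 : a₁ ≠ b)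
    (h2 : a₂ ≠ b) (h3 : a₃ ≠ b) (c₀ c₁ : R) :
    iExprT p ends o a₁ a₂ a₃ b c₀ c₁ =
      p e₀ * iExprT (restrictW p e₀) (restrictEnds ends e₀) o a₁ a₂ a₃ y c₀ c₁ := by
  rw [iExprT_eq, iExprT_eq]
  have m1 := prob_b_move p hl h1 (connEvent (restrictEnds ends e₀) a₁ a₃ ∩
    connEvent (restrictEnds ends e₀) a₂ o ∩ (connEvent (restrictEnds ends e₀) a₁ a₂)ᶜ)
    (preimage_restrict_update e₀ _)
  have m2 := prob_b_move p hl h1 ((connEvent (restrictEnds ends e₀) a₁ a₂)ᶜ)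
    (preimage_restrict_update e₀ _)
  have m3 := prob_b_move p hl h1 (connEvent (restrictEnds ends e₀) a₁ a₃ ∩
    (connEvent (restrictEnds ends e₀) a₁ a₂)ᶜ) (preimage_restrict_update e₀ _)
  simp only [Set.preimage_inter, Set.preimage_compl, ← connEvent_restrict hl h1 h3,
    ← connEvent_restrict hl h2 ho, ← connEvent_restrict hl h1 h2] at m1 m2 m3
  have e1 : connEvent ends a₁ b ∩ connEvent ends a₁ a₃ ∩ connEvent ends a₂ o ∩
      (connEvent ends a₁ a₂)ᶜ = connEvent ends a₁ b ∩ (connEvent ends a₁ a₃ ∩ connEvent ends a₂ o ∩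
      (connEvent ends a₁ a₂)ᶜ) := by
    simp only [Set.inter_assoc]
  have e3 : connEvent ends a₁ b ∩ connEvent ends a₁ a₃ ∩ (connEvent ends a₁ a₂)ᶜ =
      connEvent ends a₁ b ∩ (connEvent ends a₁ a₃ ∩ (connEvent ends a₁ a₂)ᶜ) := by
    simp only [Set.inter_assoc]
  rw [e1, e3, m1, m2, m3, probQ_restrict p hl h1 h2, connEvent_restrict hl h1 h3,
    connEvent_restrict hl h2 ho, connEvent_restrict hl h1 h2]
  simp only [← Set.preimage_compl, ← Set.preimage_inter, prob_restrict, Set.inter_assoc]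
  ring

variable [LinearOrder R] [IsStrictOrderedRing R]

/-- **The four forms at `a₃` for `(G − e₀, y)` give them for `(G, b)`** when `b` is a leaf at `y`. -/
theorem fourForms_of_b_move {p : E → R} (hp : IsProbVec p) (hl : IsLeafAt ends y b e₀) (ho : o ≠ b)
    (h1 : a₁ ≠ b) (h2 : a₂ ≠ b) (h3 : a₃ ≠ b)
    (h : FourForms (restrictW p e₀) (restrictEnds ends e₀) o a₁ a₂ a₃ y) :
    FourForms p ends o a₁ a₂ a₃ b := by
  obtain ⟨hii, hiiq, hi, hiq⟩ := h
  have hq := hp.nonneg e₀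
  refine ⟨?_, ?_, ?_, ?_⟩
  · unfold ZSplitII
    rw [iiExpr_eq_iiExprT, iiExprT_b_move p hl ho h1 h2 h3, Dpdo_restrict p hl ho h1 h2 h3,
      Dpd_restrict p hl h1 h2 h3]
    rw [ZSplitII, iiExpr_eq_iiExprT] at hii
    exact mul_nonneg hq hii
  · unfold ZSplitIIQ
    rw [iiExprT_b_move p hl ho h1 h2 h3, Dqo_restrict p hl ho h1 h2, probQ_restrict p hl h1 h2]
    exact mul_nonneg hq hiiq
  · unfold ZSplitI
    rw [iExpr_eq_iExprT, iExprT_b_move p hl ho h1 h2 h3, Dpdo_restrict p hl ho h1 h2 h3,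
      Dpd_restrict p hl h1 h2 h3]
    rw [ZSplitI, iExpr_eq_iExprT] at hi
    exact mul_nonneg hq hi
  · unfold ZSplitIQ
    rw [iExprT_b_move p hl ho h1 h2 h3, Dqo_restrict p hl ho h1 h2, probQ_restrict p hl h1 h2]
    exact mul_nonneg hq hiq

end BMove

/-! ## The closed classes -/

section Closed
universe u
variable {V : Type*} {R : Type*} [CommRing R] [LinearOrder R] [IsStrictOrderedRing R]
  {E : Type u} [Fintype E] [DecidableEq E] {ends : E → Sym2 V} {o a₁ a₂ a₃ b y : V} {e₀ : E}

/-- **A pendant `o` is replaced by its neighbour**: if `a₃` is closed in `G − e₀` with `y` as the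
`o`-mark, it is closed in `G` with the leaf `o` at `y` as the `o`-mark (`o ∉ {a₁, a₂, a₃, b}`). -/
theorem closedAt_of_o_move (hl : IsLeafAt ends y o e₀) (h1 : a₁ ≠ o) (h2 : a₂ ≠ o) (h3 : a₃ ≠ o)
    (hb : b ≠ o) (hc : ClosedAt R y a₁ a₂ b {e : E // e ≠ e₀} (restrictEnds ends e₀) a₃) :
    ClosedAt R o a₁ a₂ b E ends a₃ :=
  fun p hp => fourForms_of_o_move hp hl h1 h2 h3 hb (hc (restrictW p e₀) (IsProbVec.restrictW hp e₀))

/-- **A pendant `b` is replaced by its neighbour**: if `a₃` is closed in `G − e₀` with `y` as the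
`b`-mark, it is closed in `G` with the leaf `b` at `y` as the `b`-mark (`b ∉ {o, a₁, a₂, a₃}`). -/
theorem closedAt_of_b_move (hl : IsLeafAt ends y b e₀) (ho : o ≠ b) (h1 : a₁ ≠ b) (h2 : a₂ ≠ b)
    (h3 : a₃ ≠ b) (hc : ClosedAt R o a₁ a₂ y {e : E // e ≠ e₀} (restrictEnds ends e₀) a₃) :
    ClosedAt R o a₁ a₂ b E ends a₃ :=
  fun p hp => fourForms_of_b_move hp hl ho h1 h2 h3 (hc (restrictW p e₀) (IsProbVec.restrictW hp e₀))

variable {W : Set V} {P : Finset E}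

/-- **The mark `o` alone in a mark-free-otherwise pocket at `y` is replaced by `y`**: the pocket is the
pendant edge `{y, o}` (`closedAt_of_pocket'`), then the pendant `o` moves to `y` (the other pocket
edges survive as loops at `y` in the contracted graph, removable by `ThickStep.loop`). -/
theorem closedAt_of_o_pocket_move (h : IsPocket ends W y P) (he : e₀ ∈ P) (ho : o ∈ W)
    (h1 : a₁ ∉ W) (h2 : a₂ ∉ W) (ha : a₃ ∉ W) (hb : b ∉ W)
    (hc : ClosedAt R y a₁ a₂ b {e : E // e ≠ e₀} (restrictEnds (pocketEnds ends P e₀ o y) e₀) a₃) :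
    ClosedAt R o a₁ a₂ b E ends a₃ :=
  closedAt_of_pocket' (z := o) h he (Or.inr rfl) (Or.inl h1) (Or.inl h2) (Or.inl ha) (Or.inl hb)
    (closedAt_of_o_move (h.isLeafAt_pocketEnds e₀ ho) (by rintro rfl; exact h1 ho)
      (by rintro rfl; exact h2 ho) (by rintro rfl; exact ha ho) (by rintro rfl; exact hb ho) hc)

/-- **The mark `b` alone in a mark-free-otherwise pocket at `y` is replaced by `y`.** -/
theorem closedAt_of_b_pocket_move (h : IsPocket ends W y P) (he : e₀ ∈ P) (hb : b ∈ W)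
    (ho : o ∉ W) (h1 : a₁ ∉ W) (h2 : a₂ ∉ W) (ha : a₃ ∉ W)
    (hc : ClosedAt R o a₁ a₂ y {e : E // e ≠ e₀} (restrictEnds (pocketEnds ends P e₀ b y) e₀) a₃) :
    ClosedAt R o a₁ a₂ b E ends a₃ :=
  closedAt_of_pocket' (z := b) h he (Or.inl ho) (Or.inl h1) (Or.inl h2) (Or.inl ha) (Or.inr rfl)
    (closedAt_of_b_move (h.isLeafAt_pocketEnds e₀ hb) (by rintro rfl; exact ho hb)
      (by rintro rfl; exact h1 hb) (by rintro rfl; exact h2 hb) (by rintro rfl; exact ha hb) hc)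

end Closed

end CaseOne

end Summit.Ventures.PercRepro2
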